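import Mathlib.Algebra.Order.Field.Basic
import Mathlib.Algebra.Order.BigOperators.Group.Finset
import Mathlib.Algebra.BigOperators.Group.Finset.Basic
import Mathlib.Tactic.Ring
import Mathlib.Tactic.Linarith
import Mathlib.Tactic.LinearCombination
import Summits.Ventures.CertifiedArithmetic.LowPrec.SRStep
import HarnessLib

/-!
# Stochastic rounding into a finite format, II: recursive summation — exact mean and variance

HONEST FRAMING: certified error envelopes and provably optimal rounding/accumulation schemes for
low-precision formats under stated cost models; every table by two implementations; no hardware or
vendor claims.

File 2 of 3. Recursive summation `ŝ₀ = s`, `ŝₖ₊₁ = SR(ŝₖ + xₖ)` into a finite format `F`, every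
rounding a fresh saturating mode-2 SR whose law depends on the current exact pre-rounding value (the
errors are dependent but mean-independent). No measure theory: the law of `ŝₙ` is a finite binary
outcome tree and we work with the backward (Kolmogorov) recursion `accExp F x n f s = E[f(ŝₙ)]`, a
nested two-term sum — exact in `K`, computable, `decide`-evaluable on concrete formats (file
`SRCertificatesFP4`). Probabilities of events are expectations of indicators.

* `accExp`, `accBias` (expected cumulative saturation defect), `accVar` (`∑ₖ E[v_F(cₖ)]`), and the
  decidable path predicates `NoSat` (no branch saturates), `GapLE G` (candidate gaps `≤ G` on every
  branch), `AllOutcomes P` (with Boolean evaluators for kernel certificates);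
* `accExp_id` — **UNCONDITIONAL mean decomposition** `E[ŝₙ] = s + ∑ xₖ + accBias`;
  `accExp_id_of_noSat` — `E[ŝₙ] = s + ∑ xₖ` when no branch saturates: the finite-format form of CHM21
  Thm 4.13 (summation), valid through the subnormal range and at ties;
* `accExp_sq_sub` — **EXACT variance identity** `E[(ŝₙ − a)²] = accVar + (s + ∑ xₖ − a)²`
  (orthogonality of the mean-independent increments).

References: [ConnollyHighamMary2021] Thm 4.13, Lemma 4.5; [ArarEtAl2023] Lemma 3.1 (variance approach).
Positioning: FLoPS [ChangParkLimNagarakatte2026] formalises P3109 formats and SR variants in Lean for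
INDEPENDENT roundings; the dependent accumulation case, the exact variance identity and the saturation
criterion are this venture's additions.
-/

namespace Summit.Ventures.CertifiedArithmetic.LowPrec.SR

open Literature.ComputerArithmetic.ConnollyHighamMary2021
open Finset

variable {K : Type*} [Field K] [LinearOrder K] [IsStrictOrderedRing K]

/-! ### Recursive summation: the backward recursion -/

/-- `accExp F x n f s = E[f(ŝₙ)]` for `ŝ₀ = s`, `ŝₖ₊₁ = SR(ŝₖ + x k)` (saturating mode-2 SR into
`F`, a fresh rounding at every step). -/
def accExp (F : Finset K) : (ℕ → K) → ℕ → (K → K) → K → K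
  | _, 0, f, s => f s
  | x, n + 1, f, s => step F (s + x 0) (accExp F (fun i => x (i + 1)) n f)

/-- Expected cumulative saturation defect `∑ₖ E[clamp(cₖ) − cₖ]`. -/
def accBias (F : Finset K) : (ℕ → K) → ℕ → K → K
  | _, 0, _ => 0
  | x, n + 1, s => (clamp F (s + x 0) - (s + x 0))
      + step F (s + x 0) (accBias F (fun i => x (i + 1)) n)

/-- Accumulated variance `∑ₖ E[v_F(clamp cₖ)]`: the sum of the expected one-step conditional
variances along the process. -/
def accVar (F : Finset K) : (ℕ → K) → ℕ → K → K
  | _, 0, _ => 0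
  | x, n + 1, s => srVar F (clamp F (s + x 0))
      + step F (s + x 0) (accVar F (fun i => x (i + 1)) n)

/-- `NoSat F x n s`: no pre-rounding value on any branch of the outcome tree leaves the hull. -/
def NoSat (F : Finset K) : (ℕ → K) → ℕ → K → Prop
  | _, 0, _ => True
  | x, n + 1, s => InHull F (s + x 0) ∧ NoSat F (fun i => x (i + 1)) n (up F (s + x 0))
      ∧ NoSat F (fun i => x (i + 1)) n (dn F (s + x 0))

/-- `GapLE F G x n s`: every (clamped) pre-rounding value on every branch has candidate gap
`⌈c̄⌉ − ⌊c̄⌋ ≤ G`. -/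
def GapLE (F : Finset K) (G : K) : (ℕ → K) → ℕ → K → Prop
  | _, 0, _ => True
  | x, n + 1, s => (roundUp F (clamp F (s + x 0)) - roundDown F (clamp F (s + x 0)) ≤ G)
      ∧ GapLE F G (fun i => x (i + 1)) n (up F (s + x 0))
      ∧ GapLE F G (fun i => x (i + 1)) n (dn F (s + x 0))

/-- `AllOutcomes F x n P s`: every leaf value `ŝₙ` of the outcome tree satisfies `P`. -/
def AllOutcomes (F : Finset K) : (ℕ → K) → ℕ → (K → Prop) → K → Prop
  | _, 0, P, s => P s
  | x, n + 1, P, s => AllOutcomes F (fun i => x (i + 1)) n P (up F (s + x 0))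
      ∧ AllOutcomes F (fun i => x (i + 1)) n P (dn F (s + x 0))

/-- Boolean evaluator of `NoSat` (clean kernel reduction for `decide` certificates). -/
def noSatB (F : Finset K) : (ℕ → K) → ℕ → K → Bool
  | _, 0, _ => true
  | x, n + 1, s => decide (InHull F (s + x 0)) && noSatB F (fun i => x (i + 1)) n (up F (s + x 0))
      && noSatB F (fun i => x (i + 1)) n (dn F (s + x 0))

omit [IsStrictOrderedRing K] in
/-- `noSatB` computes `NoSat`. -/
theorem noSatB_iff (F : Finset K) (x : ℕ → K) (n : ℕ) (s : K) :
    noSatB F x n s = true ↔ NoSat F x n s := by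
  induction n generalizing x s with
  | zero => simp [noSatB, NoSat]
  | succ n ih => simp [noSatB, NoSat, ih, Bool.and_eq_true, and_assoc]

/-- `NoSat` is decidable (via `noSatB`). -/
instance instDecidableNoSat (F : Finset K) (x : ℕ → K) (n : ℕ) (s : K) :
    Decidable (NoSat F x n s) :=
  decidable_of_iff _ (noSatB_iff F x n s)

/-- Boolean evaluator of `GapLE`. -/
def gapLEB (F : Finset K) (G : K) : (ℕ → K) → ℕ → K → Bool
  | _, 0, _ => true
  | x, n + 1, s => decide (roundUp F (clamp F (s + x 0)) - roundDown F (clamp F (s + x 0)) ≤ G)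
      && gapLEB F G (fun i => x (i + 1)) n (up F (s + x 0))
      && gapLEB F G (fun i => x (i + 1)) n (dn F (s + x 0))

omit [IsStrictOrderedRing K] in
/-- `gapLEB` computes `GapLE`. -/
theorem gapLEB_iff (F : Finset K) (G : K) (x : ℕ → K) (n : ℕ) (s : K) :
    gapLEB F G x n s = true ↔ GapLE F G x n s := by
  induction n generalizing x s with
  | zero => simp [gapLEB, GapLE]
  | succ n ih => simp [gapLEB, GapLE, ih, Bool.and_eq_true, and_assoc]

/-- `GapLE` is decidable (via `gapLEB`). -/
instance instDecidableGapLE (F : Finset K) (G : K) (x : ℕ → K) (n : ℕ) (s : K) :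
    Decidable (GapLE F G x n s) :=
  decidable_of_iff _ (gapLEB_iff F G x n s)

/-- Boolean evaluator of `AllOutcomes` for a decidable predicate. -/
def allOutcomesB (F : Finset K) (P : K → Prop) [DecidablePred P] : (ℕ → K) → ℕ → K → Bool
  | _, 0, s => decide (P s)
  | x, n + 1, s => allOutcomesB F P (fun i => x (i + 1)) n (up F (s + x 0))
      && allOutcomesB F P (fun i => x (i + 1)) n (dn F (s + x 0))

omit [IsStrictOrderedRing K] in
/-- `allOutcomesB` computes `AllOutcomes`. -/
theorem allOutcomesB_iff (F : Finset K) (P : K → Prop) [DecidablePred P] (x : ℕ → K) (n : ℕ)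
    (s : K) : allOutcomesB F P x n s = true ↔ AllOutcomes F x n P s := by
  induction n generalizing x s with
  | zero => simp [allOutcomesB, AllOutcomes]
  | succ n ih => simp [allOutcomesB, AllOutcomes, ih, Bool.and_eq_true]

/-- `AllOutcomes` is decidable for a decidable predicate (via `allOutcomesB`). -/
instance instDecidableAllOutcomes (F : Finset K) (P : K → Prop) [DecidablePred P] (x : ℕ → K)
    (n : ℕ) (s : K) : Decidable (AllOutcomes F x n P s) :=
  decidable_of_iff _ (allOutcomesB_iff F P x n s)

/-! ### Linearity, positivity, monotonicity of the expectation operator -/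

omit [IsStrictOrderedRing K] in
/-- Total mass one: the expectation of a constant is the constant. -/
theorem accExp_const (F : Finset K) (x : ℕ → K) (n : ℕ) (a s : K) :
    accExp F x n (fun _ => a) s = a := by
  induction n generalizing x s with
  | zero => rfl
  | succ n ih =>
      simp only [accExp]
      rw [show accExp F (fun i => x (i + 1)) n (fun _ => a) = fun _ => a from funext (ih _), step_const]

omit [IsStrictOrderedRing K] in
/-- Linearity of `accExp`: additivity. -/
theorem accExp_add (F : Finset K) (x : ℕ → K) (n : ℕ) (f g : K → K) (s : K) :
    accExp F x n (fun t => f t + g t) s = accExp F x n f s + accExp F x n g s := by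
  induction n generalizing x s with
  | zero => rfl
  | succ n ih =>
      simp only [accExp]
      rw [← step_add]
      exact step_congr F _ (ih _ _) (ih _ _)

omit [IsStrictOrderedRing K] in
/-- Linearity of `accExp`: scalars. -/
theorem accExp_mul_left (F : Finset K) (x : ℕ → K) (n : ℕ) (a : K) (f : K → K) (s : K) :
    accExp F x n (fun t => a * f t) s = a * accExp F x n f s := by
  induction n generalizing x s with
  | zero => rfl
  | succ n ih =>
      simp only [accExp]
      rw [← step_mul_left]
      exact step_congr F _ (ih _ _) (ih _ _)

/-- Monotonicity of `accExp`. -/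
theorem accExp_mono (F : Finset K) (x : ℕ → K) (n : ℕ) {f g : K → K} (h : ∀ t, f t ≤ g t)
    (s : K) : accExp F x n f s ≤ accExp F x n g s := by
  induction n generalizing x s with
  | zero => exact h s
  | succ n ih => simp only [accExp]; exact step_mono F _ (fun t => ih _ t)

/-- Positivity of `accExp`. -/
theorem accExp_nonneg (F : Finset K) (x : ℕ → K) (n : ℕ) {f : K → K} (h : ∀ t, 0 ≤ f t)
    (s : K) : 0 ≤ accExp F x n f s := by
  have := accExp_mono F x n (f := fun _ => (0 : K)) (g := f) h s
  rwa [accExp_const] at this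

omit [IsStrictOrderedRing K] in
/-- `accExp` respects pointwise equality of integrands. -/
theorem accExp_congr (F : Finset K) (x : ℕ → K) (n : ℕ) {f g : K → K} (h : ∀ t, f t = g t)
    (s : K) : accExp F x n f s = accExp F x n g s := by
  rw [show f = g from funext h]

/-! ### Mean: exact decomposition and unbiasedness without saturation -/

omit [IsStrictOrderedRing K] in
/-- **Mean decomposition (unconditional).** `E[ŝₙ] = s + ∑_{k<n} xₖ + accBias`: the only source of
bias in SR recursive summation into a finite format is saturation. -/
theorem accExp_id (F : Finset K) (x : ℕ → K) (n : ℕ) (s : K) :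
    accExp F x n (fun t => t) s = s + ∑ i ∈ range n, x i + accBias F x n s := by
  induction n generalizing x s with
  | zero => simp [accExp, accBias]
  | succ n ih =>
      simp only [accExp, accBias]
      rw [sum_range_succ' x n]
      have key : step F (s + x 0) (accExp F (fun i => x (i + 1)) n fun t => t)
          = step F (s + x 0) (fun t => t)
            + step F (s + x 0) (fun _ => ∑ i ∈ range n, x (i + 1))
            + step F (s + x 0) (accBias F (fun i => x (i + 1)) n) := by
        rw [← step_add, ← step_add]
        exact step_congr F _ (ih _ _) (ih _ _)
      rw [key, step_id, step_const]
      ring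

omit [IsStrictOrderedRing K] in
/-- Without a saturating branch the expected saturation defect vanishes. -/
theorem accBias_eq_zero_of_noSat (F : Finset K) (x : ℕ → K) (n : ℕ) (s : K)
    (h : NoSat F x n s) : accBias F x n s = 0 := by
  induction n generalizing x s with
  | zero => rfl
  | succ n ih =>
      obtain ⟨hc, hu, hd⟩ := h
      simp only [accBias]
      rw [clamp_eq_self hc, sub_self, zero_add]
      rw [step_congr F _ (g := fun _ => (0 : K)) (ih _ _ hu) (ih _ _ hd), step_const]

omit [IsStrictOrderedRing K] in
/-- **Unbiasedness of SR recursive summation into a finite format** (finite-format form of CHM21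
Thm 4.13, summation case): if no branch saturates, `E[ŝₙ] = s + ∑_{k<n} xₖ` exactly — subnormal
spacing, ties, any word length. -/
theorem accExp_id_of_noSat (F : Finset K) (x : ℕ → K) (n : ℕ) (s : K) (h : NoSat F x n s) :
    accExp F x n (fun t => t) s = s + ∑ i ∈ range n, x i := by
  rw [accExp_id, accBias_eq_zero_of_noSat F x n s h, add_zero]

/-! ### Variance: the exact identity -/

/-- **Exact variance identity.** Without saturation, for every centre `a`,
`E[(ŝₙ − a)²] = accVar + (s + ∑ xₖ − a)²`; with `a = s + ∑ xₖ`: `Var[ŝₙ] = ∑ₖ E[v_F(cₖ)]`. -/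
theorem accExp_sq_sub (F : Finset K) (x : ℕ → K) (n : ℕ) (s : K) (h : NoSat F x n s) (a : K) :
    accExp F x n (fun t => (t - a) ^ 2) s = accVar F x n s + (s + ∑ i ∈ range n, x i - a) ^ 2 := by
  induction n generalizing x s a with
  | zero => simp [accExp, accVar]
  | succ n ih =>
      obtain ⟨hc, hu, hd⟩ := h
      simp only [accExp, accVar]
      rw [sum_range_succ' x n]
      set c := s + x 0 with hc_def
      set S := ∑ i ∈ range n, x (i + 1) with hS
      have key : step F c (accExp F (fun i => x (i + 1)) n fun t => (t - a) ^ 2)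
          = step F c (accVar F (fun i => x (i + 1)) n) + step F c (fun t => (t + (S - a)) ^ 2) := by
        rw [← step_add]
        refine step_congr F _ ?_ ?_
        · rw [ih _ _ hu]; ring
        · rw [ih _ _ hd]; ring
      rw [key, step_sq_add, clamp_eq_self hc]
      ring

/-- The variance about the exact sum. -/
theorem accExp_sq_sub_sum (F : Finset K) (x : ℕ → K) (n : ℕ) (s : K) (h : NoSat F x n s) :
    accExp F x n (fun t => (t - (s + ∑ i ∈ range n, x i)) ^ 2) s = accVar F x n s := by
  rw [accExp_sq_sub F x n s h, sub_self, zero_pow two_ne_zero, add_zero]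

end Summit.Ventures.CertifiedArithmetic.LowPrec.SR
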